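import Summits.SmoothPoincare4.SmoothPoincare4.Theorems.SymplecticOrigamiGromovRecognitionRelEndStubFlatLeavesAux
import Summits.SmoothPoincare4.SmoothPoincare4.Theorems.SymplecticOrigamiGromovRecognitionRelEndStubFlatLeavesAux2
import Literature.Geometry.Symplectic.ExactNoJSpheres
import Mathlib

/-!
# Flat leaves for `GromovRecognitionRelEnd` — leaf constancy: a `J`-sphere transverse to no
leaf lies in a leaf (stub `stub_flatLeaves` of line `cross-cap-laurent`, crux
`SymplecticOrigami.GromovRecognitionRelEnd`, item stmt-SmoothPoincare4-11009; third auxiliary file)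

The analytic heart of the stub, chart-free in `X` and generic in the leaf data.  Let `lam : X → X`
be a `C^∞` map of an almost complex `4`-manifold `(X, J)` whose differential has `J`-invariant
kernel and POSITIVE HOLONOMY (`d lam (J v) = α d lam v + β J (d lam v)` with `β > 0` whenever
`d lam v ≠ 0`), taking values, on an open set `S`, in the axis `{π₂ = 0}` of a holomorphic chart
`η : D → X` (`D ⊆ ℝ⁴` open, `η` an injective local diffeomorphism with `J ∘ dη = dη ∘ (i ⊕ i)`),
read through the complementary complex coordinate `π₁` (`π₁ ∘ (i ⊕ i) = i π₁`).  Let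
`u, v : ℂ → S` be the two affine charts of a `C^∞` sphere (`v z = u (1/z)`), `u` `J`-holomorphic.
Then (`leaf_const`) `lam` is constant on the sphere: `lam (u z) = lam (v 0)` for all `z`.

Proof (Gromov 1985, 2.4.A₂′, the orientation count without homology): `g := π₁ ∘ η⁻¹ ∘ lam ∘ u`
and `h := π₁ ∘ η⁻¹ ∘ lam ∘ v` are `C^∞` maps `ℂ → ℂ` with `h z = g (1/z)`; by holomorphy of `u`
and of `η⁻¹`, invariance of `ker d lam` and positive holonomy, the Jacobian of `g` is POINTWISE
`β |∂g/∂x|² ≥ 0` (`jacobian_formula`); the planar lemma fed in as the hypothesis `hdet`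
(`stub_sphereDetVanishes`: a smooth map `ℂP¹ → ℂ` with Jacobian `≥ 0` has Jacobian `≡ 0`) kills
it; since `π₂ ∘ η⁻¹ ∘ lam` vanishes identically near the sphere, `d(η⁻¹)` is injective and
`β > 0`, this forces `d(lam ∘ u) = 0`, so `lam ∘ u` is constant
(`Literature.Geometry.Symplectic.apply_eq_apply_zero_of_mfderiv_eq_zero`) and equal to
`lam (v 0)` by continuity of `lam ∘ v` at `0`.

Everything is proved; no definition, no named fact.

References: M. Gromov, *Pseudo holomorphic curves in symplectic manifolds*, Invent. Math. 82
(1985), 2.4.A₁′–A₂′ [Gromov1985]; D. McDuff, D. Salamon, *Introduction to Symplectic Topology*,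
3rd ed. (2017), Rem. 4.5.2 (v) [McDuffSalamon2017].
-/

noncomputable section

-- the registered namespace `Summit.SmoothPoincare4.SmoothPoincare4.Theorems…` repeats a component
set_option linter.dupNamespace false

open scoped Manifold ContDiff Topology
open Set Function Filter Literature.Geometry.Symplectic

namespace Summit.SmoothPoincare4.SmoothPoincare4.Theorems.GromovRecognitionRelEnd.CrossCapLaurent

namespace FlatLeaves

open CapModel

/-! ## Pointwise linear algebra of the Jacobian -/

/-- If `b = α a + β (i a)` then `det(a, b) = a_re b_im - a_im b_re = β |a|²`. [folklore] -/
theorem det_eq_of_eq_lin (a b : ℂ) (α β : ℝ) (hb : b = α • a + β • (Complex.I * a)) :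
    a.re * b.im - a.im * b.re = β * (a.re ^ 2 + a.im ^ 2) := by
  subst hb
  simp
  ring

/-- `a_re² + a_im² = 0` forces `a = 0`. [folklore] -/
theorem eq_zero_of_sq_add_sq_eq_zero {a : ℂ} (h : a.re ^ 2 + a.im ^ 2 = 0) : a = 0 := by
  have h0 : a.re ^ 2 = 0 := by nlinarith [sq_nonneg a.re, sq_nonneg a.im]
  have h1 : a.im ^ 2 = 0 := by nlinarith [sq_nonneg a.re, sq_nonneg a.im]
  exact Complex.ext (pow_eq_zero_iff two_ne_zero |>.1 h0) (pow_eq_zero_iff two_ne_zero |>.1 h1)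

section Core

variable {X : Type*} [TopologicalSpace X] [ChartedSpace (EuclideanSpace ℝ (Fin 4)) X]

/-! ## Derivatives of coordinates of `η⁻¹ ∘ lam` along curves -/

omit [TopologicalSpace X] [ChartedSpace (EuclideanSpace ℝ (Fin 4)) X] in
/-- **Axis structure.** On `S`, `lam` takes values in `η (D ∩ {π₂ = 0})`: `lam y ∈ η '' D` and
`π₂ (η⁻¹ (lam y)) = 0`. [folklore] -/
theorem mem_image_and_coord_eq_zero {lam : X → X} {η : EuclideanSpace ℝ (Fin 4) → X} {D : Set (EuclideanSpace ℝ (Fin 4))} {π₂ : EuclideanSpace ℝ (Fin 4) →L[ℝ] ℂ}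
    {S : Set X} (hinj : InjOn η D) (hSax : ∀ y ∈ S, ∃ p ∈ D, π₂ p = 0 ∧ η p = lam y) {y : X}
    (hy : y ∈ S) : lam y ∈ η '' D ∧ π₂ (invFunOn η D (lam y)) = 0 := by
  obtain ⟨p, hp, hp0, hpy⟩ := hSax y hy
  refine ⟨⟨p, hp, hpy⟩, ?_⟩
  rw [← hpy, invFunOn_apply_of_mem hinj hp, hp0]

variable {JX : ∀ y : X, TangentSpace (𝓡 4) y →L[ℝ] TangentSpace (𝓡 4) y}
  {lam : X → X} {η : EuclideanSpace ℝ (Fin 4) → X} {D : Set (EuclideanSpace ℝ (Fin 4))} {π₁ π₂ : EuclideanSpace ℝ (Fin 4) →L[ℝ] ℂ} {S : Set X}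

/-- **`η⁻¹ ∘ lam` is `C^∞` at the points of `S`.** [folklore] -/
theorem contMDiffAt_invFunOn_comp (hlam : ContMDiff (𝓡 4) (𝓡 4) ∞ lam) (hD : IsOpen D)
    (hη : IsLocalDiffeomorphOn 𝓘(ℝ, EuclideanSpace ℝ (Fin 4)) (𝓡 4) ∞ η D) (hinj : InjOn η D)
    (hSax : ∀ y ∈ S, ∃ p ∈ D, π₂ p = 0 ∧ η p = lam y) {y : X} (hy : y ∈ S) :
    ContMDiffAt (𝓡 4) 𝓘(ℝ, EuclideanSpace ℝ (Fin 4)) ∞ (fun y' => invFunOn η D (lam y')) y :=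
  (contMDiffAt_invFunOn_of_mem hD hη hinj (mem_image_and_coord_eq_zero hinj hSax hy).1).comp y
    (hlam y)

/-- The differential of `η⁻¹ ∘ lam` at a point of `S` is `d(η⁻¹) ∘ d lam`. [folklore] -/
theorem hasMFDerivAt_invFunOn_comp (hlam : ContMDiff (𝓡 4) (𝓡 4) ∞ lam) (hD : IsOpen D)
    (hη : IsLocalDiffeomorphOn 𝓘(ℝ, EuclideanSpace ℝ (Fin 4)) (𝓡 4) ∞ η D) (hinj : InjOn η D)
    (hSax : ∀ y ∈ S, ∃ p ∈ D, π₂ p = 0 ∧ η p = lam y) {y : X} (hy : y ∈ S) :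
    HasMFDerivAt (𝓡 4) 𝓘(ℝ, EuclideanSpace ℝ (Fin 4)) (fun y' => invFunOn η D (lam y')) y
      ((mfderiv (𝓡 4) 𝓘(ℝ, EuclideanSpace ℝ (Fin 4)) (invFunOn η D) (lam y)).comp (mfderiv (𝓡 4) (𝓡 4) lam y)) :=
  ((contMDiffAt_invFunOn_of_mem hD hη hinj
    (mem_image_and_coord_eq_zero hinj hSax hy).1).mdifferentiableAt (by simp)).hasMFDerivAt.comp y
    ((hlam y).mdifferentiableAt (by simp)).hasMFDerivAt

/-- **The transverse coordinate is infinitesimally constant along `lam`**: on the open set `S`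
the function `π₂ ∘ η⁻¹ ∘ lam` vanishes identically, so `π₂ (d(η⁻¹) (d lam V)) = 0` for every
tangent vector `V` at a point of `S`. [folklore] -/
theorem coord_mfderiv_eq_zero (hlam : ContMDiff (𝓡 4) (𝓡 4) ∞ lam) (hD : IsOpen D)
    (hη : IsLocalDiffeomorphOn 𝓘(ℝ, EuclideanSpace ℝ (Fin 4)) (𝓡 4) ∞ η D) (hinj : InjOn η D) (hS : IsOpen S)
    (hSax : ∀ y ∈ S, ∃ p ∈ D, π₂ p = 0 ∧ η p = lam y) {y : X} (hy : y ∈ S)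
    (V : TangentSpace (𝓡 4) y) :
    π₂ (mfderiv (𝓡 4) 𝓘(ℝ, EuclideanSpace ℝ (Fin 4)) (invFunOn η D) (lam y) (mfderiv (𝓡 4) (𝓡 4) lam y V)) = 0 := by
  set F : X → EuclideanSpace ℝ (Fin 4) := fun y' => invFunOn η D (lam y') with hF
  have h1 : HasMFDerivAt (𝓡 4) 𝓘(ℝ, ℂ) (fun y' => π₂ (F y')) y
      ((π₂ : EuclideanSpace ℝ (Fin 4) →L[ℝ] ℂ).comp ((mfderiv (𝓡 4) 𝓘(ℝ, EuclideanSpace ℝ (Fin 4)) (invFunOn η D) (lam y)).comp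
        (mfderiv (𝓡 4) (𝓡 4) lam y))) :=
    (hasMFDerivAt_iff_hasFDerivAt.2 (π₂ : EuclideanSpace ℝ (Fin 4) →L[ℝ] ℂ).hasFDerivAt).comp y
      (hasMFDerivAt_invFunOn_comp hlam hD hη hinj hSax hy)
  have h2 : HasMFDerivAt (𝓡 4) 𝓘(ℝ, ℂ) (fun y' => π₂ (F y')) y
      (0 : TangentSpace (𝓡 4) y →L[ℝ] TangentSpace 𝓘(ℝ, ℂ) (π₂ (F y))) := by
    refine (hasMFDerivAt_const (I := 𝓡 4) (I' := 𝓘(ℝ, ℂ)) (0 : ℂ) y).congr_of_eventuallyEq ?_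
    filter_upwards [hS.mem_nhds hy] with y' hy'
    exact (mem_image_and_coord_eq_zero hinj hSax hy').2
  have h := hasMFDerivAt_unique h1 h2
  exact congrArg (fun L : TangentSpace (𝓡 4) y →L[ℝ] ℂ => L V) h

/-! ## The Jacobian of `g = π₁ ∘ η⁻¹ ∘ lam ∘ u` -/

/-- **The derivative of `g = π₁ ∘ η⁻¹ ∘ lam ∘ u`**, applied to a vector:
`dg_z ζ = π₁ (d(η⁻¹) (d lam (du_z ζ)))`. [folklore] -/
theorem fderiv_g_apply (hlam : ContMDiff (𝓡 4) (𝓡 4) ∞ lam) (hD : IsOpen D)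
    (hη : IsLocalDiffeomorphOn 𝓘(ℝ, EuclideanSpace ℝ (Fin 4)) (𝓡 4) ∞ η D) (hinj : InjOn η D)
    (hSax : ∀ y ∈ S, ∃ p ∈ D, π₂ p = 0 ∧ η p = lam y) {u : ℂ → X}
    (hu : ContMDiff 𝓘(ℝ, ℂ) (𝓡 4) ∞ u) {z : ℂ} (hz : u z ∈ S) (ζ : ℂ) :
    fderiv ℝ (fun t : ℂ => π₁ (invFunOn η D (lam (u t)))) z ζ =
      π₁ (mfderiv (𝓡 4) 𝓘(ℝ, EuclideanSpace ℝ (Fin 4)) (invFunOn η D) (lam (u z))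
        (mfderiv (𝓡 4) (𝓡 4) lam (u z) (mfderiv 𝓘(ℝ, ℂ) (𝓡 4) u z ζ))) := by
  have hπ : HasMFDerivAt 𝓘(ℝ, EuclideanSpace ℝ (Fin 4)) 𝓘(ℝ, ℂ) (π₁ : EuclideanSpace ℝ (Fin 4) → ℂ) (invFunOn η D (lam (u z)))
      (π₁ : EuclideanSpace ℝ (Fin 4) →L[ℝ] ℂ) :=
    hasMFDerivAt_iff_hasFDerivAt.2 (π₁ : EuclideanSpace ℝ (Fin 4) →L[ℝ] ℂ).hasFDerivAt
  have h : HasMFDerivAt 𝓘(ℝ, ℂ) 𝓘(ℝ, ℂ) (fun t : ℂ => π₁ (invFunOn η D (lam (u t)))) z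
      ((π₁ : EuclideanSpace ℝ (Fin 4) →L[ℝ] ℂ).comp (((mfderiv (𝓡 4) 𝓘(ℝ, EuclideanSpace ℝ (Fin 4)) (invFunOn η D) (lam (u z))).comp
        (mfderiv (𝓡 4) (𝓡 4) lam (u z))).comp (mfderiv 𝓘(ℝ, ℂ) (𝓡 4) u z))) :=
    hπ.comp z ((hasMFDerivAt_invFunOn_comp hlam hD hη hinj hSax hz).comp z
      ((hu z).mdifferentiableAt (by simp)).hasMFDerivAt)
  rw [← mfderiv_eq_fderiv, h.mfderiv]
  rfl

/-- **`g = π₁ ∘ η⁻¹ ∘ lam ∘ u` is `C^∞`** when the `C^∞` curve `u` runs in `S`. [folklore] -/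
theorem contDiff_g (hlam : ContMDiff (𝓡 4) (𝓡 4) ∞ lam) (hD : IsOpen D)
    (hη : IsLocalDiffeomorphOn 𝓘(ℝ, EuclideanSpace ℝ (Fin 4)) (𝓡 4) ∞ η D) (hinj : InjOn η D)
    (hSax : ∀ y ∈ S, ∃ p ∈ D, π₂ p = 0 ∧ η p = lam y) {u : ℂ → X}
    (hu : ContMDiff 𝓘(ℝ, ℂ) (𝓡 4) ∞ u) (huS : ∀ z, u z ∈ S) :
    ContDiff ℝ ∞ (fun t : ℂ => π₁ (invFunOn η D (lam (u t)))) := by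
  have h : ContMDiff 𝓘(ℝ, ℂ) 𝓘(ℝ, EuclideanSpace ℝ (Fin 4)) ∞ (fun t => invFunOn η D (lam (u t))) := fun z =>
    (contMDiffAt_invFunOn_comp hlam hD hη hinj hSax (huS z)).comp z (hu z)
  exact (π₁ : EuclideanSpace ℝ (Fin 4) →L[ℝ] ℂ).contDiff.comp h.contDiff

/-- **Pointwise Jacobian formula** (Gromov 1985, 2.4.A₂′: a leaf of the second family is either
tangent or positively transverse to the first).  At a point `z` of a `J`-holomorphic curve `u` in
`S`, with `A := d lam (du_z 1)`: either `A = 0`, and then `dg_z = 0` on `1` and `i`; or `A ≠ 0`,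
and then `dg_z(i) = α dg_z(1) + β i dg_z(1)` with the holonomy coefficient `β > 0` (so the Jacobian
of `g` at `z` is `β |dg_z(1)|² ≥ 0`). [cite: Gromov1985, 2.4.A₂′] -/
theorem jacobian_formula (hlam : ContMDiff (𝓡 4) (𝓡 4) ∞ lam)
    (hker : ∀ (y : X) (v : TangentSpace (𝓡 4) y), mfderiv (𝓡 4) (𝓡 4) lam y v = 0 →
      mfderiv (𝓡 4) (𝓡 4) lam y (JX y v) = 0)
    (hpos : ∀ (y : X) (v : TangentSpace (𝓡 4) y), mfderiv (𝓡 4) (𝓡 4) lam y v ≠ 0 →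
      ∃ α β : ℝ, 0 < β ∧ mfderiv (𝓡 4) (𝓡 4) lam y (JX y v) =
        α • mfderiv (𝓡 4) (𝓡 4) lam y v + β • JX (lam y) (mfderiv (𝓡 4) (𝓡 4) lam y v))
    (hD : IsOpen D) (hη : IsLocalDiffeomorphOn 𝓘(ℝ, EuclideanSpace ℝ (Fin 4)) (𝓡 4) ∞ η D) (hinj : InjOn η D)
    (hhol : ∀ p ∈ D, ∀ q : EuclideanSpace ℝ (Fin 4),
      JX (η p) (mfderiv 𝓘(ℝ, EuclideanSpace ℝ (Fin 4)) (𝓡 4) η p q) = mfderiv 𝓘(ℝ, EuclideanSpace ℝ (Fin 4)) (𝓡 4) η p (I4 q))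
    (hπ₁ : ∀ q : EuclideanSpace ℝ (Fin 4), π₁ (I4 q) = Complex.I * π₁ q)
    (hSax : ∀ y ∈ S, ∃ p ∈ D, π₂ p = 0 ∧ η p = lam y) {u : ℂ → X}
    (hu : ContMDiff 𝓘(ℝ, ℂ) (𝓡 4) ∞ u) (huhol : IsJHolomorphic (𝓡 4) JX u) {z : ℂ}
    (hz : u z ∈ S) :
    (mfderiv (𝓡 4) (𝓡 4) lam (u z) (mfderiv 𝓘(ℝ, ℂ) (𝓡 4) u z (1 : ℂ)) = 0 ∧
        fderiv ℝ (fun t : ℂ => π₁ (invFunOn η D (lam (u t)))) z 1 = 0 ∧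
        fderiv ℝ (fun t : ℂ => π₁ (invFunOn η D (lam (u t)))) z Complex.I = 0) ∨
      (mfderiv (𝓡 4) (𝓡 4) lam (u z) (mfderiv 𝓘(ℝ, ℂ) (𝓡 4) u z (1 : ℂ)) ≠ 0 ∧ ∃ α β : ℝ,
        0 < β ∧ fderiv ℝ (fun t : ℂ => π₁ (invFunOn η D (lam (u t)))) z Complex.I =
          α • fderiv ℝ (fun t : ℂ => π₁ (invFunOn η D (lam (u t)))) z 1 +
            β • (Complex.I * fderiv ℝ (fun t : ℂ => π₁ (invFunOn η D (lam (u t)))) z 1)) := by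
  have hmem : lam (u z) ∈ η '' D := (mem_image_and_coord_eq_zero hinj hSax hz).1
  -- model-space copies of the three differentials and of the two complex structures
  obtain ⟨Lu, hLu⟩ : ∃ L : ℂ →L[ℝ] EuclideanSpace ℝ (Fin 4), L = mfderiv 𝓘(ℝ, ℂ) (𝓡 4) u z := ⟨_, rfl⟩
  obtain ⟨Ll, hLl⟩ : ∃ L : EuclideanSpace ℝ (Fin 4) →L[ℝ] EuclideanSpace ℝ (Fin 4), L = mfderiv (𝓡 4) (𝓡 4) lam (u z) := ⟨_, rfl⟩
  obtain ⟨Li, hLi⟩ : ∃ L : EuclideanSpace ℝ (Fin 4) →L[ℝ] EuclideanSpace ℝ (Fin 4),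
      L = mfderiv (𝓡 4) 𝓘(ℝ, EuclideanSpace ℝ (Fin 4)) (invFunOn η D) (lam (u z)) := ⟨_, rfl⟩
  obtain ⟨J1, hJ1⟩ : ∃ L : EuclideanSpace ℝ (Fin 4) →L[ℝ] EuclideanSpace ℝ (Fin 4), L = JX (u z) := ⟨_, rfl⟩
  obtain ⟨J2, hJ2⟩ : ∃ L : EuclideanSpace ℝ (Fin 4) →L[ℝ] EuclideanSpace ℝ (Fin 4), L = JX (lam (u z)) := ⟨_, rfl⟩
  -- the data, read in these copies
  have e1 : fderiv ℝ (fun t : ℂ => π₁ (invFunOn η D (lam (u t)))) z 1 = π₁ (Li (Ll (Lu 1))) := by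
    subst hLu hLl hLi
    exact fderiv_g_apply hlam hD hη hinj hSax hu hz 1
  have eI : fderiv ℝ (fun t : ℂ => π₁ (invFunOn η D (lam (u t)))) z Complex.I =
      π₁ (Li (Ll (Lu Complex.I))) := by
    subst hLu hLl hLi
    exact fderiv_g_apply hlam hD hη hinj hSax hu hz Complex.I
  have hI : Lu Complex.I = J1 (Lu 1) := by
    subst hLu hJ1
    have h := huhol z 1
    rw [mul_one] at h
    exact h
  have hk : Ll (Lu 1) = 0 → Ll (J1 (Lu 1)) = 0 := by
    subst hLu hLl hJ1
    exact hker (u z) _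
  have hp : Ll (Lu 1) ≠ 0 →
      ∃ α β : ℝ, 0 < β ∧ Ll (J1 (Lu 1)) = α • Ll (Lu 1) + β • J2 (Ll (Lu 1)) := by
    subst hLu hLl hJ1 hJ2
    exact hpos (u z) _
  have hLiJ : ∀ w : EuclideanSpace ℝ (Fin 4), Li (J2 w) = I4 (Li w) := by
    subst hLi hJ2
    exact fun w => mfderiv_invFunOn_map_of_mem hD hη hinj (JP := fun _ => I4) hhol hmem w
  by_cases hA0 : Ll (Lu 1) = 0
  · left
    refine ⟨?_, ?_, ?_⟩
    · subst hLu hLl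
      exact hA0
    · rw [e1, hA0, map_zero, map_zero]
    · rw [eI, hI, hk hA0, map_zero, map_zero]
  · right
    obtain ⟨α, β, hβ, hαβ⟩ := hp hA0
    refine ⟨?_, α, β, hβ, ?_⟩
    · subst hLu hLl
      exact hA0
    · rw [eI, hI, hαβ, e1, map_add, map_smul, map_smul, hLiJ, map_add, map_smul, map_smul, hπ₁]

/-- **The Jacobian of `g` is non-negative** at every point of a `J`-holomorphic curve in `S`.
[cite: Gromov1985, 2.4.A₂′] -/
theorem jacobian_nonneg (hlam : ContMDiff (𝓡 4) (𝓡 4) ∞ lam)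
    (hker : ∀ (y : X) (v : TangentSpace (𝓡 4) y), mfderiv (𝓡 4) (𝓡 4) lam y v = 0 →
      mfderiv (𝓡 4) (𝓡 4) lam y (JX y v) = 0)
    (hpos : ∀ (y : X) (v : TangentSpace (𝓡 4) y), mfderiv (𝓡 4) (𝓡 4) lam y v ≠ 0 →
      ∃ α β : ℝ, 0 < β ∧ mfderiv (𝓡 4) (𝓡 4) lam y (JX y v) =
        α • mfderiv (𝓡 4) (𝓡 4) lam y v + β • JX (lam y) (mfderiv (𝓡 4) (𝓡 4) lam y v))
    (hD : IsOpen D) (hη : IsLocalDiffeomorphOn 𝓘(ℝ, EuclideanSpace ℝ (Fin 4)) (𝓡 4) ∞ η D) (hinj : InjOn η D)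
    (hhol : ∀ p ∈ D, ∀ q : EuclideanSpace ℝ (Fin 4),
      JX (η p) (mfderiv 𝓘(ℝ, EuclideanSpace ℝ (Fin 4)) (𝓡 4) η p q) = mfderiv 𝓘(ℝ, EuclideanSpace ℝ (Fin 4)) (𝓡 4) η p (I4 q))
    (hπ₁ : ∀ q : EuclideanSpace ℝ (Fin 4), π₁ (I4 q) = Complex.I * π₁ q)
    (hSax : ∀ y ∈ S, ∃ p ∈ D, π₂ p = 0 ∧ η p = lam y) {u : ℂ → X}
    (hu : ContMDiff 𝓘(ℝ, ℂ) (𝓡 4) ∞ u) (huhol : IsJHolomorphic (𝓡 4) JX u) {z : ℂ}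
    (hz : u z ∈ S) :
    0 ≤ (fderiv ℝ (fun t : ℂ => π₁ (invFunOn η D (lam (u t)))) z 1).re *
          (fderiv ℝ (fun t : ℂ => π₁ (invFunOn η D (lam (u t)))) z Complex.I).im -
        (fderiv ℝ (fun t : ℂ => π₁ (invFunOn η D (lam (u t)))) z 1).im *
          (fderiv ℝ (fun t : ℂ => π₁ (invFunOn η D (lam (u t)))) z Complex.I).re := by
  rcases jacobian_formula hlam hker hpos hD hη hinj hhol hπ₁ hSax hu huhol hz with
    ⟨-, h1, hI⟩ | ⟨-, α, β, hβ, hαβ⟩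
  · rw [h1, hI]
    simp
  · rw [det_eq_of_eq_lin _ _ α β hαβ]
    positivity

/-- **Vanishing Jacobian forces tangency.**  If moreover the Jacobian of `g` vanishes at `z`,
then `d lam (du_z 1) = 0`: otherwise `β |dg_z(1)|² = 0` with `β > 0` gives `π₁ (d(η⁻¹) A) = 0`,
while `π₂ (d(η⁻¹) A) = 0` identically, so `d(η⁻¹) A = 0` and `A = 0` by injectivity of
`d(η⁻¹)`. [cite: Gromov1985, 2.4.A₂′] -/
theorem mfderiv_eq_zero_of_jacobian_eq_zero (hlam : ContMDiff (𝓡 4) (𝓡 4) ∞ lam)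
    (hker : ∀ (y : X) (v : TangentSpace (𝓡 4) y), mfderiv (𝓡 4) (𝓡 4) lam y v = 0 →
      mfderiv (𝓡 4) (𝓡 4) lam y (JX y v) = 0)
    (hpos : ∀ (y : X) (v : TangentSpace (𝓡 4) y), mfderiv (𝓡 4) (𝓡 4) lam y v ≠ 0 →
      ∃ α β : ℝ, 0 < β ∧ mfderiv (𝓡 4) (𝓡 4) lam y (JX y v) =
        α • mfderiv (𝓡 4) (𝓡 4) lam y v + β • JX (lam y) (mfderiv (𝓡 4) (𝓡 4) lam y v))
    (hD : IsOpen D) (hη : IsLocalDiffeomorphOn 𝓘(ℝ, EuclideanSpace ℝ (Fin 4)) (𝓡 4) ∞ η D) (hinj : InjOn η D)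
    (hhol : ∀ p ∈ D, ∀ q : EuclideanSpace ℝ (Fin 4),
      JX (η p) (mfderiv 𝓘(ℝ, EuclideanSpace ℝ (Fin 4)) (𝓡 4) η p q) = mfderiv 𝓘(ℝ, EuclideanSpace ℝ (Fin 4)) (𝓡 4) η p (I4 q))
    (hπ₁ : ∀ q : EuclideanSpace ℝ (Fin 4), π₁ (I4 q) = Complex.I * π₁ q)
    (hπ : ∀ q : EuclideanSpace ℝ (Fin 4), π₁ q = 0 → π₂ q = 0 → q = 0) (hS : IsOpen S)
    (hSax : ∀ y ∈ S, ∃ p ∈ D, π₂ p = 0 ∧ η p = lam y) {u : ℂ → X}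
    (hu : ContMDiff 𝓘(ℝ, ℂ) (𝓡 4) ∞ u) (huhol : IsJHolomorphic (𝓡 4) JX u) {z : ℂ}
    (hz : u z ∈ S)
    (hdet0 : (fderiv ℝ (fun t : ℂ => π₁ (invFunOn η D (lam (u t)))) z 1).re *
          (fderiv ℝ (fun t : ℂ => π₁ (invFunOn η D (lam (u t)))) z Complex.I).im -
        (fderiv ℝ (fun t : ℂ => π₁ (invFunOn η D (lam (u t)))) z 1).im *
          (fderiv ℝ (fun t : ℂ => π₁ (invFunOn η D (lam (u t)))) z Complex.I).re = 0) :
    mfderiv (𝓡 4) (𝓡 4) lam (u z) (mfderiv 𝓘(ℝ, ℂ) (𝓡 4) u z (1 : ℂ)) = 0 := by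
  rcases jacobian_formula hlam hker hpos hD hη hinj hhol hπ₁ hSax hu huhol hz with
    ⟨h0, -, -⟩ | ⟨hA0, α, β, hβ, hαβ⟩
  · exact h0
  · exfalso
    have hmem : lam (u z) ∈ η '' D := (mem_image_and_coord_eq_zero hinj hSax hz).1
    obtain ⟨Lu, hLu⟩ : ∃ L : ℂ →L[ℝ] EuclideanSpace ℝ (Fin 4), L = mfderiv 𝓘(ℝ, ℂ) (𝓡 4) u z := ⟨_, rfl⟩
    obtain ⟨Ll, hLl⟩ : ∃ L : EuclideanSpace ℝ (Fin 4) →L[ℝ] EuclideanSpace ℝ (Fin 4), L = mfderiv (𝓡 4) (𝓡 4) lam (u z) := ⟨_, rfl⟩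
    obtain ⟨Li, hLi⟩ : ∃ L : EuclideanSpace ℝ (Fin 4) →L[ℝ] EuclideanSpace ℝ (Fin 4),
        L = mfderiv (𝓡 4) 𝓘(ℝ, EuclideanSpace ℝ (Fin 4)) (invFunOn η D) (lam (u z)) := ⟨_, rfl⟩
    have e1 : fderiv ℝ (fun t : ℂ => π₁ (invFunOn η D (lam (u t)))) z 1 =
        π₁ (Li (Ll (Lu 1))) := by
      subst hLu hLl hLi
      exact fderiv_g_apply hlam hD hη hinj hSax hu hz 1
    have h2 : π₂ (Li (Ll (Lu 1))) = 0 := by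
      subst hLu hLl hLi
      exact coord_mfderiv_eq_zero hlam hD hη hinj hS hSax hz _
    have hLi0 : ∀ w : EuclideanSpace ℝ (Fin 4), Li w = 0 → w = 0 := by
      subst hLi
      exact fun w hw => mfderiv_invFunOn_eq_zero hD hη hinj hmem hw
    have hA0' : Ll (Lu 1) ≠ 0 := by
      subst hLu hLl
      exact hA0
    rw [det_eq_of_eq_lin _ _ α β hαβ] at hdet0
    have hsq : (fderiv ℝ (fun t : ℂ => π₁ (invFunOn η D (lam (u t)))) z 1).re ^ 2 +
        (fderiv ℝ (fun t : ℂ => π₁ (invFunOn η D (lam (u t)))) z 1).im ^ 2 = 0 := by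
      rcases mul_eq_zero.1 hdet0 with hb | hs
      · exact absurd hb hβ.ne'
      · exact hs
    have h1 : π₁ (Li (Ll (Lu 1))) = 0 := by
      rw [← e1]
      exact eq_zero_of_sq_add_sq_eq_zero hsq
    exact hA0' (hLi0 _ (hπ _ h1 h2))

/-! ## Leaf constancy -/

/-- **Leaf constancy** (Gromov 1985, 2.4.A₂′, read relative to the wedge; McDuff–Salamon 2017,
Rem. 4.5.2 (v)).  With the notation of the file header: if the planar lemma `hdet` holds (a `C^∞`
map `ℂP¹ → ℂ`, given by two affine charts `g`, `h = g (1/z)`, with everywhere non-negative Jacobian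
has identically vanishing Jacobian), then `lam` is constant on the `J`-sphere `(u, v)`:
`lam (u z) = lam (v 0)` for every `z`. [cite: Gromov1985, 2.4.A₂′] -/
theorem leaf_const [IsManifold (𝓡 4) ∞ X] [T2Space X] (hlam : ContMDiff (𝓡 4) (𝓡 4) ∞ lam)
    (hker : ∀ (y : X) (v : TangentSpace (𝓡 4) y), mfderiv (𝓡 4) (𝓡 4) lam y v = 0 →
      mfderiv (𝓡 4) (𝓡 4) lam y (JX y v) = 0)
    (hpos : ∀ (y : X) (v : TangentSpace (𝓡 4) y), mfderiv (𝓡 4) (𝓡 4) lam y v ≠ 0 →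
      ∃ α β : ℝ, 0 < β ∧ mfderiv (𝓡 4) (𝓡 4) lam y (JX y v) =
        α • mfderiv (𝓡 4) (𝓡 4) lam y v + β • JX (lam y) (mfderiv (𝓡 4) (𝓡 4) lam y v))
    (hD : IsOpen D) (hη : IsLocalDiffeomorphOn 𝓘(ℝ, EuclideanSpace ℝ (Fin 4)) (𝓡 4) ∞ η D) (hinj : InjOn η D)
    (hhol : ∀ p ∈ D, ∀ q : EuclideanSpace ℝ (Fin 4),
      JX (η p) (mfderiv 𝓘(ℝ, EuclideanSpace ℝ (Fin 4)) (𝓡 4) η p q) = mfderiv 𝓘(ℝ, EuclideanSpace ℝ (Fin 4)) (𝓡 4) η p (I4 q))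
    (hπ₁ : ∀ q : EuclideanSpace ℝ (Fin 4), π₁ (I4 q) = Complex.I * π₁ q)
    (hπ : ∀ q : EuclideanSpace ℝ (Fin 4), π₁ q = 0 → π₂ q = 0 → q = 0)
    (hS : IsOpen S) (hSax : ∀ y ∈ S, ∃ p ∈ D, π₂ p = 0 ∧ η p = lam y)
    {u v : ℂ → X} (hu : ContMDiff 𝓘(ℝ, ℂ) (𝓡 4) ∞ u) (hv : ContMDiff 𝓘(ℝ, ℂ) (𝓡 4) ∞ v)
    (huv : ∀ z : ℂ, z ≠ 0 → v z = u z⁻¹) (huhol : IsJHolomorphic (𝓡 4) JX u)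
    (huS : ∀ z, u z ∈ S) (hvS : ∀ z, v z ∈ S)
    (hdet : ∀ (g h : ℂ → ℂ), ContDiff ℝ ∞ g → ContDiff ℝ ∞ h →
      (∀ z : ℂ, z ≠ 0 → h z = g z⁻¹) →
      (∀ z : ℂ, 0 ≤ (fderiv ℝ g z 1).re * (fderiv ℝ g z Complex.I).im -
        (fderiv ℝ g z 1).im * (fderiv ℝ g z Complex.I).re) →
      ∀ z : ℂ, (fderiv ℝ g z 1).re * (fderiv ℝ g z Complex.I).im -
        (fderiv ℝ g z 1).im * (fderiv ℝ g z Complex.I).re = 0)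
    (z : ℂ) : lam (u z) = lam (v 0) := by
  have hgs : ContDiff ℝ ∞ (fun t : ℂ => π₁ (invFunOn η D (lam (u t)))) :=
    contDiff_g hlam hD hη hinj hSax hu huS
  have hhs : ContDiff ℝ ∞ (fun t : ℂ => π₁ (invFunOn η D (lam (v t)))) :=
    contDiff_g hlam hD hη hinj hSax hv hvS
  have hgh : ∀ t : ℂ, t ≠ 0 → (fun t : ℂ => π₁ (invFunOn η D (lam (v t)))) t =
      (fun t : ℂ => π₁ (invFunOn η D (lam (u t)))) t⁻¹ := by
    intro t ht
    simp only [huv t ht]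
  have hdet0 := hdet _ _ hgs hhs hgh
    (fun t => jacobian_nonneg hlam hker hpos hD hη hinj hhol hπ₁ hSax hu huhol (huS t))
  -- Step 1: `d lam (du_t 1) = 0` for every `t`
  have hA : ∀ t : ℂ,
      mfderiv (𝓡 4) (𝓡 4) lam (u t) (mfderiv 𝓘(ℝ, ℂ) (𝓡 4) u t (1 : ℂ)) = 0 := fun t =>
    mfderiv_eq_zero_of_jacobian_eq_zero hlam hker hpos hD hη hinj hhol hπ₁ hπ hS hSax hu huhol
      (huS t) (hdet0 t)
  -- Step 2: `d(lam ∘ u) = 0`, so `lam ∘ u` is constant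
  have hlu : ContMDiff 𝓘(ℝ, ℂ) (𝓡 4) 1 (lam ∘ u) :=
    (hlam.comp hu).of_le (by exact_mod_cast le_top)
  have hdu : ∀ t, mfderiv 𝓘(ℝ, ℂ) (𝓡 4) (lam ∘ u) t = 0 := by
    intro t
    rw [mfderiv_comp t ((hlam (u t)).mdifferentiableAt (by simp))
      ((hu t).mdifferentiableAt (by simp))]
    apply clm_eq_zero_of_apply_one_of_apply_I
    · exact hA t
    · show mfderiv (𝓡 4) (𝓡 4) lam (u t) (mfderiv 𝓘(ℝ, ℂ) (𝓡 4) u t Complex.I) = 0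
      have hI : mfderiv 𝓘(ℝ, ℂ) (𝓡 4) u t Complex.I =
          JX (u t) (mfderiv 𝓘(ℝ, ℂ) (𝓡 4) u t (1 : ℂ)) := by
        have h := huhol t 1
        rw [mul_one] at h
        exact h
      rw [hI]
      exact hker _ _ (hA t)
  have hconst : ∀ t, lam (u t) = lam (u 0) := fun t =>
    apply_eq_apply_zero_of_mfderiv_eq_zero hlu hdu t
  -- Step 3: continuity of `lam ∘ v` at `0`
  have hv0 : lam (v 0) = lam (u 0) := by
    have hc : ContinuousAt (fun t => lam (v t)) 0 :=
      (hlam.continuous.comp hv.continuous).continuousAt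
    refine eq_of_forall_ne_zero_eq (f := fun t => lam (v t)) hc fun t ht => ?_
    show lam (v t) = lam (u 0)
    rw [huv t ht, hconst]
  rw [hconst z, hv0]

end Core

end FlatLeaves

/-- **Registered helper sub-goal `helper_flatLeavesJacobianSign`** (third auxiliary file of stub
`stub_flatLeaves`): the pointwise sign of the Jacobian used in the leaf-constancy argument — if
`b = α a + β (i a)` with `β ≥ 0` then `a_re b_im - a_im b_re = β |a|² ≥ 0`. [folklore] -/
theorem helper_flatLeavesJacobianSign : ∀ (a b : ℂ) (α β : ℝ), 0 ≤ β →
    b = α • a + β • (Complex.I * a) → 0 ≤ a.re * b.im - a.im * b.re := by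
  intro a b α β hβ hb
  rw [FlatLeaves.det_eq_of_eq_lin a b α β hb]
  positivity

end Summit.SmoothPoincare4.SmoothPoincare4.Theorems.GromovRecognitionRelEnd.CrossCapLaurent
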